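import Summits.CriticalPhenomena.PercolationContinuityZ3.Theorems.Transplant.PlanarSkeletonFrmScaledDefs
import Summits.CriticalPhenomena.PercolationContinuityZ3.Theorems.Transplant.PlanarSkeletonFrmRays
import HarnessLib

/-!
# Scaled Φ2 port, I: connectedness, RAYS of exact `N`-steps, and the UNIFORM FIBRE-ADJUSTMENT bound inside width-`ℓ₀` cylinders for
# `PlanarSkeletonFrmScaled` (the structure-agnostic first file of the port planned in HOME/prim-bschramm-p4-g16/SCALED-PHI2-PORT.md)

builds on p205010 (kernel theorem, internal audit signed; external expert review pending) — nothing in this file uses p205010; nothing here is a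
claim about the open node `SamePDropOfSkeletonFrmScaled₁`.  Lane `prim-bschramm`, seat `prim-bschramm-p4` gen 16 (PART C3 of `P4-GENERAL.md`
§38.5: the scaled Φ2 port).  Helper file (`--supports stmt-CriticalPhenomena-4575 --as helper`).  No probability.

Twin of gen 14's `PlanarSkeletonFrmRays` (III) §1 and §3 over the SCALED interface (three integers `L`, `N`, `ℓ₀` instead of `1, 1, 1`):
* §0 `graph_connected` — a `PlanarSkeletonFrmScaled` graph with a base vertex is connected (any two vertices lie in one wide cylinder at a base vertex,
  connected by (κ′)); hence the `G.Connected` binder of `continuity_of_frmScaledNode₁` is dischargeable from the skeleton (`continuity_of_frmScaledNode₁_conn`).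
* §1 `exists_ray`: a walk of `k` exact `N`-steps in direction `σ eᵢ` whose `j`-th vertex sits at `φ v + j N σ eᵢ`; `ray_coords_one/zero`.
* §2 `exists_adjust_bound`: for every `D` a bound `M` such that any two vertices of EQUAL chart position at graph distance `≤ D` are joined by a walk of
  length `≤ M` inside the cylinder of half-width `ℓ₀` around them (the ONE place where (κ′) enters the Φ2 argument, cf. P4-GENERAL §38.5; compactness:
  frames + finite balls).
[cite: KozmaNitzan2024, §4 p. 15 (boxes and their translates); p. 26 ((29))] [cite: AizenmanGrimmett1991, Thm 1 (essential enhancements)]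
-/

noncomputable section

namespace Summit.CriticalPhenomena.PercolationContinuityZ3.Theorems.Transplant

namespace PlanarSkeletonFrmScaled

open SimpleGraph Walk Literature.Probability.LatticeModels Literature.Probability.Percolation
open Literature.Barriers.CriticalPhenomena (graphBall graphBall_finite countable_of_connected_of_locallyFinite)
open scoped Classical

variable {V : Type} {G : SimpleGraph V} [G.LocallyFinite] (Φ : PlanarSkeletonFrmScaled G)

/-! ## §0 Connectedness from the skeleton -/

/-- Two vertices of a wide enough cylinder at a base vertex are joined inside it ((κ′)). [cite: KozmaNitzan2024, §4 p. 15] -/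
theorem exists_walk_in_cyl {t' : V} (ht' : t' ∈ Φ.types) {ℓ : ℕ} (hℓ : Φ.ℓ₀ ≤ ℓ) {u w : V} (hu : Φ.φ u - Φ.φ t' ∈ box 2 ℓ)
    (hw : Φ.φ w - Φ.φ t' ∈ box 2 ℓ) : ∃ W : G.Walk u w, ∀ z ∈ W.support, Φ.φ z - Φ.φ t' ∈ box 2 ℓ := by
  have hconn := Φ.cyl_connected t' ht' ℓ hℓ
  obtain ⟨W₀⟩ := hconn.preconnected ⟨u, hu⟩ ⟨w, hw⟩
  have key : ∀ z ∈ (W₀.map (Embedding.induce {w | Φ.φ w - Φ.φ t' ∈ box 2 ℓ}).toHom).support, Φ.φ z - Φ.φ t' ∈ box 2 ℓ := by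
    intro z hz
    rw [Walk.support_map, List.mem_map] at hz
    obtain ⟨z₀, -, rfl⟩ := hz
    exact z₀.2
  exact ⟨_, key⟩

/-- **A `PlanarSkeletonFrmScaled` graph with a base vertex is connected** (every vertex lies, with the base vertex, in one wide cylinder).
[cite: KozmaNitzan2024, §4 p. 15] -/
theorem graph_connected {t : V} (ht : t ∈ Φ.types) : G.Connected := by
  have key : ∀ v : V, G.Reachable t v := by
    intro v
    set ℓ : ℕ := Φ.ℓ₀ + (Φ.φ v 0 - Φ.φ t 0).natAbs + (Φ.φ v 1 - Φ.φ t 1).natAbs with hℓ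
    have hv : Φ.φ v - Φ.φ t ∈ box 2 ℓ := by
      rw [mem_box]; intro i
      fin_cases i
      · show -(ℓ : ℤ) ≤ (Φ.φ v - Φ.φ t) 0 ∧ (Φ.φ v - Φ.φ t) 0 ≤ ℓ
        rw [Pi.sub_apply]; constructor <;> omega
      · show -(ℓ : ℤ) ≤ (Φ.φ v - Φ.φ t) 1 ∧ (Φ.φ v - Φ.φ t) 1 ≤ ℓ
        rw [Pi.sub_apply]; constructor <;> omega
    have ht0 : Φ.φ t - Φ.φ t ∈ box 2 ℓ := by rw [sub_self]; exact zero_mem_box 2 ℓ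
    obtain ⟨W, -⟩ := Φ.exists_walk_in_cyl ht (by omega) ht0 hv
    exact ⟨W⟩
  exact (connected_iff _).2 ⟨fun a b => (key a).symm.trans (key b), ⟨t⟩⟩

/-- **Conditional continuity from the scaled node, connectedness derived**: one-type carrier, Φ2 at `p_c` ⟹ `θ_v(p_c) = 0` at every vertex.
[cite: BenjaminiSchramm1996, Conj. 4] -/
theorem continuity_of_frmScaledNode₁_conn (hD : SamePDropOfSkeletonFrmScaled₁) (t : V) (ht : t ∈ Φ.types) (h1 : Φ.types = {t})
    (hC : Φ.CylSubcritical (criticalProbIOf G t)) (v : V) : theta G v (criticalProbIOf G v) = 0 :=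
  continuity_of_frmScaledNode₁' hD G Φ (Φ.graph_connected ht) t ht h1 hC v

/-! ## §1 Rays of exact `N`-steps -/

/-- **A ray of `k` exact `N`-steps** in direction `σ eᵢ` from `v`: a walk of length `k` whose `j`-th vertex sits at `φ v + j N σ eᵢ`.
[cite: KozmaNitzan2024, §4 p. 26 ((29))] -/
theorem exists_ray (v : V) (i : Fin 2) (σ : ℤˣ) (k : ℕ) :
    ∃ v', ∃ W : G.Walk v v', W.length = k ∧ Φ.φ v' = Φ.φ v + Pi.single i ((k : ℤ) * Φ.N * σ) ∧
      ∀ u ∈ W.support, ∃ j : ℕ, j ≤ k ∧ Φ.φ u = Φ.φ v + Pi.single i ((j : ℤ) * Φ.N * σ) := by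
  induction k with
  | zero =>
    refine ⟨v, Walk.nil, rfl, by simp, fun u hu => ⟨0, le_rfl, ?_⟩⟩
    rw [Walk.support_nil, List.mem_singleton] at hu
    subst hu; simp
  | succ k ih =>
    obtain ⟨v', W, hlen, hφ, hsup⟩ := ih
    obtain ⟨v'', hadj, hφ''⟩ := Φ.step v' i σ
    refine ⟨v'', W.append (Walk.cons hadj Walk.nil), by rw [Walk.length_append, Walk.length_cons, Walk.length_nil, hlen], ?_, ?_⟩
    · rw [hφ'', hφ, add_assoc, ← Pi.single_add]; push_cast; ring_nf
    · intro u hu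
      rw [Walk.mem_support_append_iff, Walk.support_cons, Walk.support_nil, List.mem_cons, List.mem_singleton] at hu
      rcases hu with hu | rfl | rfl
      · obtain ⟨j, hj, hju⟩ := hsup u hu
        exact ⟨j, Nat.le_succ_of_le hj, hju⟩
      · exact ⟨k, Nat.le_succ k, hφ⟩
      · refine ⟨k + 1, le_rfl, ?_⟩
        rw [hφ'', hφ, add_assoc, ← Pi.single_add]; push_cast; ring_nf

/-- Coordinates along a ray in direction `e₁`. [folklore] -/
theorem ray_coords_one {v u : V} {σ : ℤˣ} {j : ℕ} (h : Φ.φ u = Φ.φ v + Pi.single 1 ((j : ℤ) * Φ.N * σ)) :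
    Φ.φ u 0 = Φ.φ v 0 ∧ Φ.φ u 1 = Φ.φ v 1 + j * Φ.N * σ := by
  constructor
  · rw [h, Pi.add_apply, Pi.single_eq_of_ne (by decide), add_zero]
  · rw [h, Pi.add_apply, Pi.single_eq_same]

/-- Coordinates along a ray in direction `e₀`. [folklore] -/
theorem ray_coords_zero {v u : V} {σ : ℤˣ} {j : ℕ} (h : Φ.φ u = Φ.φ v + Pi.single 0 ((j : ℤ) * Φ.N * σ)) :
    Φ.φ u 0 = Φ.φ v 0 + j * Φ.N * σ ∧ Φ.φ u 1 = Φ.φ v 1 := by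
  constructor
  · rw [h, Pi.add_apply, Pi.single_eq_same]
  · rw [h, Pi.add_apply, Pi.single_eq_of_ne (by decide), add_zero]

/-- **A ray leaves every box**: after `k` steps with `k N > 2ℓ` the endpoint of a ray from inside `Λ_ℓ(t)` is outside `Λ_ℓ(t)` (in direction `+eᵢ`).
[folklore] -/
theorem ray_exits {t v u : V} {i : Fin 2} {ℓ k : ℕ} (hv : Φ.φ v - Φ.φ t ∈ box 2 ℓ)
    (h : Φ.φ u = Φ.φ v + Pi.single i ((k : ℤ) * Φ.N * ((1 : ℤˣ) : ℤ))) (hk : 2 * (ℓ : ℤ) < k * Φ.N) :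
    Φ.φ u - Φ.φ t ∉ box 2 ℓ := by
  intro hu
  rw [mem_box] at hv hu
  have hvi := hv i
  have hui := hu i
  rw [Pi.sub_apply] at hvi hui
  rw [h, Pi.add_apply, Pi.single_eq_same, Units.val_one, mul_one] at hui
  omega

/-! ## §2 The uniform fibre-adjustment bound inside width-`ℓ₀` cylinders -/

/-- **THE UNIFORM FIBRE-ADJUSTMENT BOUND (scaled, width `ℓ₀`)**: for every `D` there is `M` such that any two vertices with the SAME skeleton
position at graph distance `≤ D` are joined by a walk of length `≤ M` inside the cylinder of half-width `ℓ₀` around them (frames reduce to the base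
vertices and the finite balls around them; (κ′) connects the width-`ℓ₀` cylinders). [cite: KozmaNitzan2024, §4 p. 15 (boxes and their translates)] -/
theorem exists_adjust_bound (D : ℕ) (hne : Φ.types.Nonempty) : ∃ M : ℕ, ∀ w w' : V, Φ.φ w' = Φ.φ w → w' ∈ graphBall G w D →
    ∃ W : G.Walk w w', W.length ≤ M ∧ ∀ z ∈ W.support, Φ.φ z - Φ.φ w ∈ box 2 Φ.ℓ₀ := by
  obtain ⟨t₀, ht₀⟩ := hne
  have hconn : G.Connected := Φ.graph_connected ht₀
  -- a connecting walk inside the width-`ℓ₀` cylinder for every (base vertex, vertex over it)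
  have key : ∀ t' : V, ∀ u : V, ∃ W : G.Walk t' u, t' ∈ Φ.types → Φ.φ u = Φ.φ t' →
      ∀ z ∈ W.support, Φ.φ z - Φ.φ t' ∈ box 2 Φ.ℓ₀ := by
    intro t' u
    by_cases h : t' ∈ Φ.types ∧ Φ.φ u = Φ.φ t'
    · have ht0 : Φ.φ t' - Φ.φ t' ∈ box 2 Φ.ℓ₀ := by rw [sub_self]; exact zero_mem_box 2 _
      have hu0 : Φ.φ u - Φ.φ t' ∈ box 2 Φ.ℓ₀ := by rw [h.2, sub_self]; exact zero_mem_box 2 _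
      obtain ⟨W, hW⟩ := Φ.exists_walk_in_cyl h.1 le_rfl ht0 hu0
      exact ⟨W, fun _ _ => hW⟩
    · obtain ⟨W⟩ := hconn.preconnected t' u
      exact ⟨W, fun h1 h2 => absurd ⟨h1, h2⟩ h⟩
  choose Wf hWf using key
  let B : V → Finset V := fun t' => (graphBall_finite G t' D).toFinset
  refine ⟨Φ.types.sup fun t' => (B t').sup fun u => (Wf t' u).length, fun w w' hφ hball => ?_⟩
  obtain ⟨t', ht', α, hαt, hα⟩ := Φ.frame w
  set u := α.symm w' with hu
  have hαu : α u = w' := by rw [hu, RelIso.apply_symm_apply]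
  have hφu : Φ.φ u = Φ.φ t' := by
    have h := hα u
    rw [hαu, hφ] at h
    linear_combination -h
  have hub : u ∈ B t' := by
    rw [Set.Finite.mem_toFinset]
    have h := PlanarSkeletonFrm.mem_graphBall_map α.symm hball
    rwa [← hαt, RelIso.symm_apply_apply] at h
  refine ⟨((Wf t' u).map α.toEmbedding.toHom).copy hαt hαu, ?_, ?_⟩
  · rw [Walk.length_copy, Walk.length_map]
    exact (Finset.le_sup (f := fun u => (Wf t' u).length) hub).trans
      (Finset.le_sup (f := fun t' => (B t').sup fun u => (Wf t' u).length) ht')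
  · intro z hz
    rw [Walk.support_copy, Walk.support_map, List.mem_map] at hz
    obtain ⟨z₀, hz₀, rfl⟩ := hz
    have h := hWf t' u ht' hφu z₀ hz₀
    have e : Φ.φ ((α.toEmbedding.toHom : G →g G) z₀) - Φ.φ w = Φ.φ z₀ - Φ.φ t' := by
      show Φ.φ (α z₀) - Φ.φ w = Φ.φ z₀ - Φ.φ t'
      rw [hα z₀]; abel
    rw [e]; exact h

/-- **THE UNIFORM ADJUSTMENT BOUND WITH NEARBY (NOT EQUAL) CHART POSITIONS** (the run of the scaled kit, SCALED-PHI2-PORT "design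
correction"): for every `D` and widths `W' ≤ W` with `ℓ₀ ≤ W` there is `M` such that any two vertices at graph distance `≤ D` whose chart positions
differ by at most `W'` are joined by a walk of length `≤ M` inside the cylinder of half-width `W` around the first (frames reduce to base vertices and
finite balls; (κ′) connects width-`W` cylinders). [cite: KozmaNitzan2024, §4 p. 15 (boxes and their translates)] -/
theorem exists_adjust_bound' (D W' W : ℕ) (hW : Φ.ℓ₀ ≤ W) (hW' : W' ≤ W) (hne : Φ.types.Nonempty) :
    ∃ M : ℕ, ∀ w w' : V, Φ.φ w' - Φ.φ w ∈ box 2 W' → w' ∈ graphBall G w D →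
      ∃ P : G.Walk w w', P.length ≤ M ∧ ∀ z ∈ P.support, Φ.φ z - Φ.φ w ∈ box 2 W := by
  obtain ⟨t₀, ht₀⟩ := hne
  have hconn : G.Connected := Φ.graph_connected ht₀
  have key : ∀ t' : V, ∀ u : V, ∃ P : G.Walk t' u, t' ∈ Φ.types → Φ.φ u - Φ.φ t' ∈ box 2 W' →
      ∀ z ∈ P.support, Φ.φ z - Φ.φ t' ∈ box 2 W := by
    intro t' u
    by_cases h : t' ∈ Φ.types ∧ Φ.φ u - Φ.φ t' ∈ box 2 W'
    · have ht0 : Φ.φ t' - Φ.φ t' ∈ box 2 W := by rw [sub_self]; exact zero_mem_box 2 _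
      have hu0 : Φ.φ u - Φ.φ t' ∈ box 2 W := box_mono 2 hW' h.2
      obtain ⟨P, hP⟩ := Φ.exists_walk_in_cyl h.1 hW ht0 hu0
      exact ⟨P, fun _ _ => hP⟩
    · obtain ⟨P⟩ := hconn.preconnected t' u
      exact ⟨P, fun h1 h2 => absurd ⟨h1, h2⟩ h⟩
  choose Wf hWf using key
  let B : V → Finset V := fun t' => (graphBall_finite G t' D).toFinset
  refine ⟨Φ.types.sup fun t' => (B t').sup fun u => (Wf t' u).length, fun w w' hφ hball => ?_⟩
  obtain ⟨t', ht', α, hαt, hα⟩ := Φ.frame w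
  set u := α.symm w' with hu
  have hαu : α u = w' := by rw [hu, RelIso.apply_symm_apply]
  have hφu : Φ.φ u - Φ.φ t' ∈ box 2 W' := by
    have h := hα u
    rw [hαu] at h
    have e : Φ.φ u - Φ.φ t' = Φ.φ w' - Φ.φ w := by rw [h]; abel
    rw [e]; exact hφ
  have hub : u ∈ B t' := by
    rw [Set.Finite.mem_toFinset]
    have h := PlanarSkeletonFrm.mem_graphBall_map α.symm hball
    rwa [← hαt, RelIso.symm_apply_apply] at h
  refine ⟨((Wf t' u).map α.toEmbedding.toHom).copy hαt hαu, ?_, ?_⟩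
  · rw [Walk.length_copy, Walk.length_map]
    exact (Finset.le_sup (f := fun u => (Wf t' u).length) hub).trans
      (Finset.le_sup (f := fun t' => (B t').sup fun u => (Wf t' u).length) ht')
  · intro z hz
    rw [Walk.support_copy, Walk.support_map, List.mem_map] at hz
    obtain ⟨z₀, hz₀, rfl⟩ := hz
    have h := hWf t' u ht' hφu z₀ hz₀
    have e : Φ.φ ((α.toEmbedding.toHom : G →g G) z₀) - Φ.φ w = Φ.φ z₀ - Φ.φ t' := by
      show Φ.φ (α z₀) - Φ.φ w = Φ.φ z₀ - Φ.φ t'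
      rw [hα z₀]; abel
    rw [e]; exact h

end PlanarSkeletonFrmScaled

end Summit.CriticalPhenomena.PercolationContinuityZ3.Theorems.Transplant

end
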